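import Summits.ResolutionOfSingularities.ResolutionOfSingularities.Theorems.RadicialJungCleanModelsDimTwoFFiniteGiraudChart
import Summits.ResolutionOfSingularities.ResolutionOfSingularities.Theorems.RadicialJungCleanModelsDimTwoFFiniteGlue
import Summits.ResolutionOfSingularities.ResolutionOfSingularities.Theorems.RadicialJungCleanModelsStubGlueLocalModification
import HarnessLib

/-!
# The induction step of the dimension-2 `F`-finite cut of crux `CleanModels` (line `Sketch` rev 10)

Route `ResolutionOfSingularities/RadicialJung`, crux item `CleanModels`
(stmt-ResolutionOfSingularities-15917), line `Sketch` rev 10 (lead c2), stub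
`stub_principalizationDimTwoFFinite`. One step of the induction over a finite affine cover of the
regular surface `W`: given a proper model `π : V → W` (`V` integral, regular, of dimension `2`)
which is an isomorphism off a closed set `M ⊆ S` of closed points and is loosely clean at every
point over the open `S`, and an affine open `U`, the model is improved to one with the same
properties relative to `S ∪ U`:

1. affine avoidance (`exists_basicOpen_superset_disjoint`) gives a basic open `D ⊆ U` containing
   `U ∖ S` and missing `M`, so `π` is an isomorphism over `D` and `D' = π⁻¹(D)` is an affine open
   of `V`; on `D` the `K^p`-line of `g₀` has a regular representative `b^p g₀`
   (`exists_section_eq_pow_mul`);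
2. Giraud's theorem on the chart `D'` (`exists_giraudChart`, with the named fact
   `Giraud1983Thm24` as the expanded hypothesis `hG`) gives `πX : X' → D'`, loosely clean
   everywhere, an isomorphism off a closed set `Z ⊆ D'` of closed points;
3. `stub_glueLocalModification` patches `X'` into `V`; the glued `V'` is integral, regular, of
   dimension `2` (`isIntegral_glue`, `isRegular_glue`, `topologicalKrullDim_glue`), the new model
   `π' = ρ ≫ π` is an isomorphism off `M' = M ∪ π(Z) ⊆ S ∪ U`, and loose cleanness holds over
   `S ∪ U`: over `D` by Giraud (transported along the open immersion `X' → V'` and rewritten as a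
   representative `Σ c_j^p g₀^j` with `c_j ∈ K(W)` through the birational identifications of the
   function fields), elsewhere over `S` by hypothesis (transported along the local isomorphism
   `ρ`).
-/

noncomputable section

set_option linter.dupNamespace false -- mandated namespace of this single-conjunct summit

open CategoryTheory AlgebraicGeometry TopologicalSpace IsLocalRing
open Literature.AlgebraicGeometry.Resolution Literature.AlgebraicGeometry.Motives
open scoped TensorProduct

namespace Summit.ResolutionOfSingularities.ResolutionOfSingularities.Theorems.RadicialJung.CleanModels

universe u

/-! ## Small generalities -/

/-- A two-term representative of the `K^p`-line: with `c = (a, b', 0, …, 0)`,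
`Σ_{j<p} c_j^p g^j = a^p + b'^p g` (`p ≥ 2`). [folklore] -/
theorem sum_twoTerm {K : Type*} [CommSemiring K] {p : ℕ} (hp : 2 ≤ p) (a b' g : K) :
    ∑ j : Fin p, (if (j : ℕ) = 0 then a else if (j : ℕ) = 1 then b' else 0) ^ p * g ^ (j : ℕ) =
      a ^ p + b' ^ p * g := by
  rw [Finset.sum_eq_add_of_mem (⟨0, by omega⟩ : Fin p) ⟨1, by omega⟩ (Finset.mem_univ _)
    (Finset.mem_univ _) (by simp [Fin.ext_iff]) ?_]
  · simp
  · rintro ⟨j, hj⟩ - ⟨hj0, hj1⟩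
    have hj0' : j ≠ 0 := fun h => hj0 (Fin.ext h)
    have hj1' : j ≠ 1 := fun h => hj1 (Fin.ext h)
    simp [hj0', hj1', zero_pow (by omega : p ≠ 0)]

/-- A bijective ring map out of a field and "not a `p`-th power": if `c^p = b^p g` with `b ≠ 0`
then `g` is a `p`-th power. [folklore] -/
theorem ne_pow_mul_of_ne_pow {K : Type*} [Field K] (p : ℕ) {g b : K} (hb : b ≠ 0)
    (hg : ∀ c : K, c ^ p ≠ g) (c : K) : c ^ p ≠ b ^ p * g := by
  intro h
  apply hg (c / b)
  rw [div_pow, h, mul_div_cancel_left₀ _ (pow_ne_zero _ hb)]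

/-- In an integral scheme all of whose points of a closed set `M` are closed points and whose
generic point is not closed, the complement of `M` is a dense open. [folklore] -/
theorem dense_compl_of_forall_isClosed {X : Scheme.{u}} [IsIntegral X] {M : Set X}
    (hM : IsClosed M) (hMcl : ∀ x ∈ M, IsClosed ({x} : Set X))
    (hη : ¬ IsClosed ({genericPoint X} : Set X)) : Dense Mᶜ :=
  hM.isOpen_compl.dense ⟨genericPoint X, fun h => hη (hMcl _ h)⟩

/-- If `f` is an isomorphism over the open `U ∋ y`, then `y` has a preimage in `f⁻¹(U)`.
[folklore] -/
theorem exists_preimage_of_isIso_morphismRestrict {X Y : Scheme.{u}} (f : X ⟶ Y) (U : Y.Opens)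
    [IsIso (f ∣_ U)] {y : Y} (hy : y ∈ U) : ∃ x : X, f.base x = y := by
  obtain ⟨x, hx⟩ := (f ∣_ U).homeomorph.surjective ⟨y, hy⟩
  refine ⟨x.1, ?_⟩
  have := congrArg Subtype.val hx
  simpa [morphismRestrict_base_coe] using this

/-! ## The step -/

/-- **The induction step of the dimension-2, `F`-finite cut.** See the module docstring.
`hG` is the named fact `Giraud1983Thm24` (Giraud 1983, Thm. 2.4 with Prop. 1.5 (ii)), expanded. -/
theorem exists_step (p : ℕ) [Fact p.Prime] (k : Type) [Field k] [CharP k p] (hk : IsFFinite p 1 k)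
    (hG : ∀ (p : ℕ) [Fact p.Prime] (X : Scheme.{0}) [IsIntegral X] [CompactSpace X]
      [CharP Γ(X, ⊤) p],
      Scheme.IsRegular X → topologicalKrullDim X = 2 →
      (∀ (x : X) [CharP (X.presheaf.stalk x) p],
        (frobenius (X.presheaf.stalk x) p).Finite ∧ (frobenius (X.presheaf.stalk x) p).Flat) →
      ∀ f : Γ(X, ⊤),
        (∀ c : X.functionField, c ^ p ≠ (X.presheaf.germ ⊤ (genericPoint X) trivial) f) →
      ∃ (X' : Scheme.{0}) (π : X' ⟶ X), IsProper π ∧ IsIntegral X' ∧ Scheme.IsRegular X' ∧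
        (∃ U : X.Opens, ((U : Set X)ᶜ).Finite ∧ (∀ x ∈ (U : Set X)ᶜ, IsClosed ({x} : Set X)) ∧
          IsIso (π ∣_ U)) ∧
        ∀ x' : X', ∃ (d r : ℕ) (hrd : r ≤ d) (t : Fin d → X'.presheaf.stalk x')
          (g u : X'.presheaf.stalk x') (a : Fin r → ℕ),
          Ideal.span (Set.range t) = maximalIdeal (X'.presheaf.stalk x') ∧
          ringKrullDim (X'.presheaf.stalk x') = (d : WithBot ℕ∞) ∧ (∀ i, 2 ≤ a i) ∧
          (X'.presheaf.germ ⊤ x' trivial) (π.appTop f) =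
            g ^ p + u * ∏ i : Fin r, t (Fin.castLE hrd i) ^ a i ∧
          (((∃ i, ¬ p ∣ a i) ∧ IsUnit u) ∨
            LinearIndependent (ResidueField (X'.presheaf.stalk x'))
              (fun i => ((1 : ResidueField (X'.presheaf.stalk x')) ⊗ₜ[X'.presheaf.stalk x']
                (KaehlerDifferential.D ℤ (X'.presheaf.stalk x')
                  ((Fin.snoc (fun i : Fin r => t (Fin.castLE hrd i)) u :
                    Fin (r + 1) → X'.presheaf.stalk x') i)) :
                ResidueField (X'.presheaf.stalk x') ⊗[X'.presheaf.stalk x']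
                  (Ω[X'.presheaf.stalk x'⁄ℤ])))))
    (W : Scheme.{0}) [IsIntegral W] (f : W ⟶ Spec (.of k)) [LocallyOfFiniteType f]
    (hdimW : topologicalKrullDim W = 2) (g₀ : W.functionField)
    (hg₀ : ∀ c : W.functionField, c ^ p ≠ g₀)
    (V : Scheme.{0}) [IsIntegral V] (π : V ⟶ W) [IsDominant π] [IsProper π]
    (hVreg : Scheme.IsRegular V) (hdimV : topologicalKrullDim V = 2)
    (S : W.Opens) (M : Set W) (hM : IsClosed M) (hMcl : ∀ x ∈ M, IsClosed ({x} : Set W))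
    (hMS : M ⊆ (S : Set W)) [IsIso (π ∣_ ⟨Mᶜ, hM.isOpen_compl⟩)]
    (hclean : ∀ v : V, π.base v ∈ S →
      ∃ c : Fin p → W.functionField, (∃ j : Fin p, (j : ℕ) ≠ 0 ∧ c j ≠ 0) ∧
      ((∃ (d m : ℕ) (hmd : m ≤ d) (t : Fin d → V.presheaf.stalk v) (a : Fin m → ℕ)
          (u : V.presheaf.stalk v), IsUnit u ∧
          Ideal.span (Set.range t) = maximalIdeal (V.presheaf.stalk v) ∧
          ringKrullDim (V.presheaf.stalk v) = (d : WithBot ℕ∞) ∧ 0 < m ∧ (∀ i, ¬ p ∣ a i) ∧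
          RatFn.functionFieldMap π (∑ j : Fin p, c j ^ p * g₀ ^ (j : ℕ)) =
            algebraMap (V.presheaf.stalk v) V.functionField
              (u * ∏ i : Fin m, t (Fin.castLE hmd i) ^ (a i))) ∨
        (∃ u : V.presheaf.stalk v, IsUnit u ∧
          RatFn.functionFieldMap π (∑ j : Fin p, c j ^ p * g₀ ^ (j : ℕ)) =
            algebraMap (V.presheaf.stalk v) V.functionField u ∧
          ∀ c' : V.presheaf.stalk v, u - c' ^ p ∉ maximalIdeal (V.presheaf.stalk v)) ∨
        (∃ s c' : V.presheaf.stalk v,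
          RatFn.functionFieldMap π (∑ j : Fin p, c j ^ p * g₀ ^ (j : ℕ)) =
            algebraMap (V.presheaf.stalk v) V.functionField s ∧
          s - c' ^ p ∈ maximalIdeal (V.presheaf.stalk v) ∧
          s - c' ^ p ∉ maximalIdeal (V.presheaf.stalk v) ^ 2)))
    (U : W.Opens) (hU : IsAffineOpen U) :
    ∃ (V' : Scheme.{0}) (π' : V' ⟶ W) (_ : IsIntegral V') (_ : IsDominant π') (_ : IsProper π')
      (M' : Set W) (hM' : IsClosed M'),
      Scheme.IsRegular V' ∧ topologicalKrullDim V' = 2 ∧ (∀ x ∈ M', IsClosed ({x} : Set W)) ∧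
      M' ⊆ ((S ⊔ U : W.Opens) : Set W) ∧ IsIso (π' ∣_ ⟨M'ᶜ, hM'.isOpen_compl⟩) ∧
      ∀ v : V', π'.base v ∈ (S ⊔ U : W.Opens) →
        ∃ c : Fin p → W.functionField, (∃ j : Fin p, (j : ℕ) ≠ 0 ∧ c j ≠ 0) ∧
        ((∃ (d m : ℕ) (hmd : m ≤ d) (t : Fin d → V'.presheaf.stalk v) (a : Fin m → ℕ)
            (u : V'.presheaf.stalk v), IsUnit u ∧
            Ideal.span (Set.range t) = maximalIdeal (V'.presheaf.stalk v) ∧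
            ringKrullDim (V'.presheaf.stalk v) = (d : WithBot ℕ∞) ∧ 0 < m ∧ (∀ i, ¬ p ∣ a i) ∧
            RatFn.functionFieldMap π' (∑ j : Fin p, c j ^ p * g₀ ^ (j : ℕ)) =
              algebraMap (V'.presheaf.stalk v) V'.functionField
                (u * ∏ i : Fin m, t (Fin.castLE hmd i) ^ (a i))) ∨
          (∃ u : V'.presheaf.stalk v, IsUnit u ∧
            RatFn.functionFieldMap π' (∑ j : Fin p, c j ^ p * g₀ ^ (j : ℕ)) =
              algebraMap (V'.presheaf.stalk v) V'.functionField u ∧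
            ∀ c' : V'.presheaf.stalk v, u - c' ^ p ∉ maximalIdeal (V'.presheaf.stalk v)) ∨
          (∃ s c' : V'.presheaf.stalk v,
            RatFn.functionFieldMap π' (∑ j : Fin p, c j ^ p * g₀ ^ (j : ℕ)) =
              algebraMap (V'.presheaf.stalk v) V'.functionField s ∧
            s - c' ^ p ∈ maximalIdeal (V'.presheaf.stalk v) ∧
            s - c' ^ p ∉ maximalIdeal (V'.presheaf.stalk v) ^ 2)) := by
  classical
  have hp : p.Prime := Fact.out
  have hηW : ¬ IsClosed ({genericPoint W} : Set W) :=
    not_isClosed_singleton_genericPoint (by rw [hdimW]; decide)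
  have hηV : ¬ IsClosed ({genericPoint V} : Set V) :=
    not_isClosed_singleton_genericPoint (by rw [hdimV]; decide)
  -- (a) the chart in `W`: a basic open `D ⊆ U` containing `U ∖ S` and missing `M`
  have hdisj : (S : Set W)ᶜ ∩ M ∩ (U : Set W) = ∅ := by
    rw [Set.eq_empty_iff_forall_notMem]
    rintro x ⟨⟨hxS, hxM⟩, -⟩
    exact hxS (hMS hxM)
  obtain ⟨h, hTD, hDM⟩ := exists_basicOpen_superset_disjoint hU S.2.isClosed_compl hM hdisj
  have hDaff : IsAffineOpen (W.basicOpen h) := hU.basicOpen h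
  have hDU : (W.basicOpen h : Set W) ⊆ U := W.basicOpen_le h
  have hDMc : W.basicOpen h ≤ ⟨Mᶜ, hM.isOpen_compl⟩ := fun x hx hxM =>
    (Set.eq_empty_iff_forall_notMem.mp hDM x) ⟨hx, hxM⟩
  have hSU : ∀ x : W, x ∈ (S ⊔ U : W.Opens) → x ∉ W.basicOpen h → x ∈ S := by
    intro x hx hxD
    rcases Opens.mem_sup.mp hx with hxS | hxU
    · exact hxS
    · by_contra hxS
      exact hxD (hTD ⟨hxS, hxU⟩)
  -- the degenerate case: `D` empty, nothing to do
  by_cases hDne : ¬ (W.basicOpen h : Set W).Nonempty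
  · refine ⟨V, π, inferInstance, inferInstance, inferInstance, M, hM, hVreg, hdimV, hMcl,
      hMS.trans fun x hx => Opens.mem_sup.mpr (Or.inl hx), ‹_›, fun v hv => ?_⟩
    exact hclean v (hSU _ hv fun hD => hDne ⟨_, hD⟩)
  push Not at hDne
  haveI : IsIso (π ∣_ W.basicOpen h) := isIso_morphismRestrict_of_le π hDMc
  -- (b) the chart `D' = π⁻¹(D)` in `V`
  set D' : V.Opens := π ⁻¹ᵁ W.basicOpen h with hD'def
  haveI : IsAffine (W.basicOpen h : Scheme.{0}) := hDaff
  have hD'aff : IsAffineOpen D' := IsAffine.of_isIso (π ∣_ W.basicOpen h)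
  have hD'ne : (D' : Set V).Nonempty := by
    obtain ⟨y, hy⟩ := hDne
    obtain ⟨x, hx⟩ := exists_preimage_of_isIso_morphismRestrict π (W.basicOpen h) hy
    exact ⟨x, show π.base x ∈ W.basicOpen h by rw [hx]; exact hy⟩
  -- the regular representative `b^p g₀` on `D` and its pull-back `s` to `D'`
  obtain ⟨b, sD, hb, hsD⟩ := exists_section_eq_pow_mul hDaff hDne hp.pos g₀
  set s : Γ(V, D') := π.app (W.basicOpen h) sD with hsdef
  set r : V.functionField := RatFn.functionFieldMap π (b ^ p * g₀) with hrdef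
  have hr : r = V.presheaf.germ D' (genericPoint V)
      ((genericPoint_spec V).specializes (Set.mem_univ hD'ne.some) |>.mem_open D'.2
        hD'ne.some_mem) s := by
    have hv₀ : π.base hD'ne.some ∈ W.basicOpen h := hD'ne.some_mem
    rw [hrdef, ← hsD, ← toFunctionField_germ' (x := π.base hD'ne.some) hv₀ _ sD,
      functionFieldMap_toFunctionField_germ π hD'ne.some hv₀ sD, toFunctionField_germ' hD'ne.some_mem]
  -- `π^♯` is bijective (`π` is an isomorphism over the dense open `W ∖ M`)
  have hMdense : Dense ((⟨Mᶜ, hM.isOpen_compl⟩ : W.Opens) : Set W) :=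
    dense_compl_of_forall_isClosed hM hMcl hηW
  have hMdense' : Dense ((π ⁻¹ᵁ (⟨Mᶜ, hM.isOpen_compl⟩ : W.Opens) : V.Opens) : Set V) := by
    refine (π ⁻¹ᵁ (⟨Mᶜ, hM.isOpen_compl⟩ : W.Opens)).2.dense ?_
    obtain ⟨x, hx⟩ := exists_preimage_of_isIso_morphismRestrict π ⟨Mᶜ, hM.isOpen_compl⟩
      (y := genericPoint W) (fun hη => hηW (hMcl _ hη))
    exact ⟨x, show π.base x ∈ Mᶜ by rw [hx]; exact fun hη => hηW (hMcl _ hη)⟩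
  have hπbij : Function.Bijective (RatFn.functionFieldMap π) :=
    RatFn.functionFieldMap_bijective_of_isIso_morphismRestrict π _ hMdense hMdense'
  have hrp : ∀ c : V.functionField, c ^ p ≠ r :=
    ne_pow_of_bijective _ hπbij p (ne_pow_mul_of_ne_pow p hb hg₀)
  -- (c) Giraud's theorem on the chart
  haveI : LocallyOfFiniteType (π ≫ f) := inferInstance
  obtain ⟨X', πX, hX'int, hπXdom, hπXιdom, hπXprop, hX'reg, ⟨Z, hZ, hZD', hZcl, hZiso⟩, hptX⟩ :=
    exists_giraudChart p k hk hG (π ≫ f) hVreg hdimV D' hD'aff hD'ne s r hr hrp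
  haveI := hX'int; haveI := hπXprop; haveI := hZiso; haveI := hπXdom; haveI := hπXιdom
  -- (d) glue the chart into `V`
  obtain ⟨V', ρ, e, hρprop, he, heρ, hrange, hρiso⟩ :=
    stub_glueLocalModification D' πX Z hZ hZD'
  haveI := hρprop; haveI := he; haveI := hρiso
  set O : V.Opens := ⟨Zᶜ, hZ.isOpen_compl⟩ with hOdef
  have hcover : ∀ v' : V', v' ∈ Set.range e.base ∨ ρ.base v' ∈ O := by
    intro v'
    by_cases hv : ρ.base v' ∈ (D' : Set V)
    · left; rw [hrange]; exact hv
    · right; exact fun hz => hv (hZD' hz)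
  -- the generic point of `V` lies in `D' ∖ Z`, under a point of `X'`
  have hηD' : genericPoint V ∈ D' :=
    (genericPoint_spec V).specializes (Set.mem_univ hD'ne.some) |>.mem_open D'.2 hD'ne.some_mem
  have hηZ : genericPoint V ∉ Z := fun h => hηV (hZcl _ h)
  obtain ⟨x₀, hx₀⟩ : ∃ x₀ : X', (πX ≫ D'.ι).base x₀ = genericPoint V := by
    obtain ⟨x₀, hx₀⟩ := exists_preimage_of_isIso_morphismRestrict πX (D'.ι ⁻¹ᵁ O)
      (y := ⟨genericPoint V, hηD'⟩) hηZ
    exact ⟨x₀, by rw [Scheme.Hom.comp_apply, hx₀]; rfl⟩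
  have hx₀O : ρ.base (e.base x₀) ∈ O := by
    rw [← Scheme.Hom.comp_apply, heρ, hx₀]
    exact hηZ
  have hmeet : ∃ x' : X', ρ.base (e.base x') ∈ O := ⟨x₀, hx₀O⟩
  haveI hV'int : IsIntegral V' := isIntegral_glue ρ e O hcover hmeet
  have hV'reg : Scheme.IsRegular V' := isRegular_glue ρ e O hcover hVreg hX'reg
  haveI hρdom : IsDominant ρ := isDominant_of_isIso_morphismRestrict ρ O ⟨_, hηZ⟩
  haveI hedom : IsDominant e := ⟨by
    rw [DenseRange, hrange]
    have hmem : e.base x₀ ∈ ρ.base ⁻¹' (D' : Set V) := by rw [← hrange]; exact ⟨x₀, rfl⟩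
    exact (ρ ⁻¹ᵁ D').2.dense ⟨e.base x₀, hmem⟩⟩
  haveI : IsProper (ρ ≫ π) := inferInstance
  haveI : IsDominant (ρ ≫ π) := inferInstance
  haveI : LocallyOfFiniteType ((ρ ≫ π) ≫ f) := inferInstance
  have hdimV' : topologicalKrullDim V' = 2 :=
    (topologicalKrullDim_glue (π ≫ f) ((ρ ≫ π) ≫ f) ρ O ⟨e.base x₀, hx₀O⟩).trans hdimV
  -- the new exceptional set `M' = M ∪ π(Z)`
  have hπcl : IsClosedMap π.base := π.isClosedMap
  have hM' : IsClosed (M ∪ π.base '' Z) := hM.union (hπcl _ hZ)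
  have hM'cl : ∀ x ∈ M ∪ π.base '' Z, IsClosed ({x} : Set W) := by
    rintro x (hx | ⟨z, hz, rfl⟩)
    · exact hMcl x hx
    · rw [← Set.image_singleton]
      exact hπcl _ (hZcl z hz)
  have hM'S : M ∪ π.base '' Z ⊆ ((S ⊔ U : W.Opens) : Set W) := by
    rintro x (hx | ⟨z, hz, rfl⟩)
    · exact Opens.mem_sup.mpr (Or.inl (hMS hx))
    · exact Opens.mem_sup.mpr (Or.inr (hDU (hZD' hz)))
  have hle₁ : (⟨(M ∪ π.base '' Z)ᶜ, hM'.isOpen_compl⟩ : W.Opens) ≤ ⟨Mᶜ, hM.isOpen_compl⟩ :=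
    fun x hx hxM => hx (Or.inl hxM)
  have hle₂ : π ⁻¹ᵁ (⟨(M ∪ π.base '' Z)ᶜ, hM'.isOpen_compl⟩ : W.Opens) ≤ O :=
    fun v hv hz => hv (Or.inr ⟨v, hz, rfl⟩)
  have hπ'iso : IsIso ((ρ ≫ π) ∣_ ⟨(M ∪ π.base '' Z)ᶜ, hM'.isOpen_compl⟩) := by
    rw [morphismRestrict_comp]
    have h1 := isIso_morphismRestrict_of_le π hle₁
    have h2 := isIso_morphismRestrict_of_le ρ hle₂
    exact @IsIso.comp_isIso _ _ _ _ _ _ _ h2 h1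
  refine ⟨V', ρ ≫ π, hV'int, inferInstance, inferInstance, M ∪ π.base '' Z, hM', hV'reg, hdimV',
    hM'cl, hM'S, hπ'iso, fun v' hv' => ?_⟩
  -- (e) loose cleanness over `S ∪ U`
  by_cases hvD : ρ.base v' ∈ (D' : Set V)
  · -- over the chart: Giraud, transported along `e` and rewritten with coefficients in `K(W)`
    obtain ⟨x', rfl⟩ : v' ∈ Set.range e.base := by rw [hrange]; exact hvD
    obtain ⟨c₀, c₁, hc₁, hLC⟩ := hptX x'
    -- the identifications of function fields
    have hebij := RatFn.functionFieldMap_bijective_of_isOpenImmersion e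
    set E : X'.functionField ≃+* V'.functionField :=
      (RingEquiv.ofBijective (RatFn.functionFieldMap e) hebij).symm with hEdef
    have hEe : ∀ y, RatFn.functionFieldMap e (E y) = y := fun y =>
      (RingEquiv.ofBijective (RatFn.functionFieldMap e) hebij).apply_symm_apply y
    set eO : X'.presheaf.stalk x' ≃+* V'.presheaf.stalk (e.base x') :=
      (asIso (e.stalkMap x')).commRingCatIsoToRingEquiv.symm with heOdef
    have hEcompat : ∀ a, E.toRingHom (algebraMap (X'.presheaf.stalk x') X'.functionField a) =
        algebraMap (V'.presheaf.stalk (e.base x')) V'.functionField (eO a) := by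
      intro a
      apply hebij.1
      rw [RingEquiv.toRingHom_eq_coe, RingHom.coe_coe, hEe]
      change _ = RatFn.functionFieldMap e (RatFn.toFunctionField (e.base x') (eO a))
      rw [RatFn.functionFieldMap_toFunctionField]
      change _ = RatFn.toFunctionField x' ((asIso (e.stalkMap x')).hom ((asIso (e.stalkMap x')).inv a))
      rw [Iso.inv_hom_id_apply]
    have hLC' := looseClean_of_ringEquiv p eO E.toRingHom hEcompat _ hLC
    -- `π'^♯` is bijective
    have hM'dense : Dense ((⟨(M ∪ π.base '' Z)ᶜ, hM'.isOpen_compl⟩ : W.Opens) : Set W) :=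
      dense_compl_of_forall_isClosed hM' hM'cl hηW
    have hM'dense' : Dense (((ρ ≫ π) ⁻¹ᵁ (⟨(M ∪ π.base '' Z)ᶜ, hM'.isOpen_compl⟩ : W.Opens) :
        V'.Opens) : Set V') := by
      haveI := hπ'iso
      refine ((ρ ≫ π) ⁻¹ᵁ (⟨(M ∪ π.base '' Z)ᶜ, hM'.isOpen_compl⟩ : W.Opens)).2.dense ?_
      have hηM' : genericPoint W ∈ (⟨(M ∪ π.base '' Z)ᶜ, hM'.isOpen_compl⟩ : W.Opens) :=
        fun hη => hηW (hM'cl _ hη)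
      obtain ⟨x, hx⟩ := exists_preimage_of_isIso_morphismRestrict (ρ ≫ π) _ hηM'
      exact ⟨x, show (ρ ≫ π).base x ∈ (M ∪ π.base '' Z)ᶜ by rw [hx]; exact hηM'⟩
    haveI := hπ'iso
    have hπ'bij : Function.Bijective (RatFn.functionFieldMap (ρ ≫ π)) :=
      RatFn.functionFieldMap_bijective_of_isIso_morphismRestrict (ρ ≫ π) _ hM'dense hM'dense'
    set Φ : W.functionField ≃+* V'.functionField :=
      RingEquiv.ofBijective (RatFn.functionFieldMap (ρ ≫ π)) hπ'bij with hΦdef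
    -- the representative with coefficients in `K(W)`
    set c₀' : W.functionField := Φ.symm (E c₀)
    set c₁' : W.functionField := Φ.symm (E c₁) * b
    have hEr : E (RatFn.functionFieldMap (πX ≫ D'.ι) r) =
        RatFn.functionFieldMap (ρ ≫ π) (b ^ p * g₀) := by
      apply hebij.1
      rw [hEe, RatFn.functionFieldMap_congr heρ.symm, hrdef, RatFn.functionFieldMap_comp ρ e,
        RatFn.functionFieldMap_comp π ρ]
      rfl
    have hkey : E.toRingHom (c₀ ^ p + c₁ ^ p * RatFn.functionFieldMap (πX ≫ D'.ι) r) =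
        RatFn.functionFieldMap (ρ ≫ π) (∑ j : Fin p,
          (if (j : ℕ) = 0 then c₀' else if (j : ℕ) = 1 then c₁' else 0) ^ p * g₀ ^ (j : ℕ)) := by
      rw [sum_twoTerm hp.two_le, RingEquiv.toRingHom_eq_coe, RingHom.coe_coe, map_add, map_mul,
        map_pow, map_pow, hEr]
      change E c₀ ^ p + E c₁ ^ p * Φ (b ^ p * g₀) = Φ (c₀' ^ p + c₁' ^ p * g₀)
      simp only [map_add, map_mul, map_pow, c₀', c₁', RingEquiv.apply_symm_apply]
      ring
    rw [hkey] at hLC'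
    refine ⟨_, ⟨⟨1, hp.one_lt⟩, one_ne_zero, ?_⟩, hLC'⟩
    simp only [one_ne_zero, ↓reduceIte]
    exact mul_ne_zero (by
      rw [RingEquiv.map_ne_zero_iff, RingEquiv.map_ne_zero_iff]
      exact hc₁) hb
  · -- off the chart: `ρ` is a local isomorphism at `v'` and `π' v' ∈ S`
    have hvO : ρ.base v' ∈ O := fun hz => hvD (hZD' hz)
    have hvS : π.base (ρ.base v') ∈ S := by
      rw [Scheme.Hom.comp_apply] at hv'
      exact hSU _ hv' fun hD => hvD hD
    obtain ⟨c, hc, hLC⟩ := hclean (ρ.base v') hvS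
    haveI := isIso_stalkMap_of_mem ρ O v' hvO
    refine ⟨c, hc, ?_⟩
    have h' := looseClean_of_ringEquiv p (asIso (ρ.stalkMap v')).commRingCatIsoToRingEquiv
      (RatFn.functionFieldMap ρ) (fun a => RatFn.functionFieldMap_toFunctionField ρ v' a) _ hLC
    rwa [← RingHom.comp_apply, ← RatFn.functionFieldMap_comp] at h'

end Summit.ResolutionOfSingularities.ResolutionOfSingularities.Theorems.RadicialJung.CleanModels

end
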